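import Literature.NumberTheory.Automorphic.QuadraticRestrictionOfScalars
import Literature.NumberTheory.GaloisRepresentations.RelativeIdealNorm
import Literature.NumberTheory.GaloisRepresentations.AdicCompletionUniformizer
import Mathlib.RingTheory.Norm.Transitivity
import HarnessLib

/-!
# Local norms above a finite place: `‖N_{E/F} a‖_v = ∏_{w ∣ v} ‖a‖_w` and, for quadratic `E/F`,
# `‖N_{E ⊗_F F_v / F_v} y‖_v = ∏_{w ∣ v} ‖y_w‖_w` on `E ⊗_F F_v = ∏_{w ∣ v} E_w`
(Cassels–Fröhlich, *Algebraic Number Theory* (1967), Ch. II §11 ("`|N_{L/K} α|_v = ∏_{w ∣ v} |α|_w`");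
Neukirch, *Algebraic Number Theory* (1999), Ch. III (1.2), (1.6))

Topic `NumberTheory/Automorphic`; namespace `Literature.NumberTheory.Automorphic.UnitaryGroup` (home of the
tree's `LocalRing E v = ∏_{w ∣ v} E_w`, `QuadraticLocalBaseChange`). Proof file: **theorems only** (no definition,
no named fact, no instance, 0 proof holes).

**Setting.** `E/F` number fields, `v` a finite place of `F`, `PlacesOver E v` the places `w ∣ v` of `E`, all norms
`‖·‖_v`, `‖·‖_w` Mathlib's normalised absolute values on `v.adicCompletion F`, `w.adicCompletion E`
(`‖ϖ_v‖ = N(v)⁻¹`).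

* §1 (any `E/F`): `count_relIdealNorm` — `ν_v(N_{E/F} 𝔄) = ∑_{w ∣ v} f(w|v) ν_w(𝔄)` for invertible fractional
  ideals (from the tree's `relIdealNorm` = Artin homomorphism of `𝔔 ↦ 𝔮^{f(𝔔|𝔮)}`); `norm_coe_units_eq_absNorm_zpow` —
  `‖x‖_𝔮 = N𝔮^{-ν_𝔮((x))}`; **`norm_algebraNorm_coe_eq_prod` — `‖N_{E/F} a‖_v = ∏_{w ∣ v} ‖a‖_w`** for `a ∈ Eˣ`
  (`N𝔔 = N𝔮^{f(𝔔|𝔮)}`, Mathlib `Ideal.absNorm_eq_pow_inertiaDeg'_of_liesOver`; `N_{E/F}((a)) = (N_{E/F} a)`, tree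
  `relIdealNorm_toPrincipalIdeal`).
* §2 (quadratic `E/F`, `σ δ = -δ ≠ 0`, `δ² = d ∈ F`): `algebraNorm_quadraticLocalEquiv` —
  `N_{E⊗F_v/F_v}(ι_v a + ι_v b · δ) = a² - d b²` (matrix of multiplication in the basis `(1, δ)`);
  `toLocalRing_algebraNorm` — `ι_v(N y) = y · (σ ⊗ 1) y`; `algebraNorm_localRing_algebraMap` —
  `N_{E⊗F_v/F_v}(x ⊗ 1) = N_{E/F}(x)` (`N_{E/F} x = x · σ x`, Mathlib `Algebra.norm_eq_prod_automorphisms`);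
  continuity of the norm (private); and **`norm_algebraNorm_localRing` —
  `‖N_{E⊗F_v/F_v} y‖_v = ∏_{w ∣ v} ‖y_w‖_w` for every `y ∈ ∏_{w ∣ v} E_w`** (both sides continuous, equal on the dense
  image of `E`, tree `denseRange_algebraMap_localRing`).

## Mathlib / tree

Mathlib: `Algebra.norm` (+ `norm_eq_matrix_det`, `leftMulMatrix_eq_repr_mul`, `norm_eq_prod_automorphisms`),
`Basis.ofEquivFun`, `Ideal.absNorm_eq_pow_inertiaDeg'_of_liesOver`, `Ideal.inertiaDeg'_eq_inertiaDeg`,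
`IsDedekindDomain.HeightOneSpectrum.adicCompletion` (+ `valued_coe`), `NumberField.FinitePlace.norm_def`,
`DenseRange.induction_on`. Tree: `QuadraticLocalBaseChange` (`toLocalRing`, `quadraticLocalEquiv`,
`conjLocal_*`, `denseRange_algebraMap_localRing`, `exists_algEquiv_apply_eq_neg`), `QuadraticRestrictionOfScalars`
(`exists_mul_self_eq_algebraMap`), `RelativeIdealNorm` (`relIdealNorm`, `artinHom_relIdealNorm`,
`relIdealNorm_toPrincipalIdeal`), `RayClassGroup` (`artinHom_apply`, `count_toPrincipalIdeal`),
`AdicCompletionUniformizer` (`norm_eq_absNorm_zpow`).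

## Provenance

Written under the LEAN-IN-TREE rule for the pub-hodgecm formalisation cell (GR-1 local package of
[GelbartRogawski1991, Prop. 3.1.1], junction L8 "parabolic normalisation": the Weil side produces
`|N_{E⊗F_v/F_v}(det_Δ p)|_v^{1/2}`, the adelic side `∏_{w ∣ v} ‖det_Δ p_w‖_w^{1/2}`). Nothing in this file is a
claim of the manuscripts adjudicated by that cell.

## References

* J. W. S. Cassels, A. Fröhlich (eds.), *Algebraic Number Theory* (1967), Ch. II §11 [CasselsFrohlichANT1967].
* J. Neukirch, *Algebraic Number Theory*, Grundlehren 322 (1999), Ch. III (1.2), (1.6) [NeukirchANT1999].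
-/

noncomputable section

open NumberField IsDedekindDomain IsDedekindDomain.HeightOneSpectrum

open scoped nonZeroDivisors

namespace Literature.NumberTheory.Automorphic.UnitaryGroup

open Literature.NumberTheory.GaloisRepresentations

/-! ## 1. `‖N_{E/F} a‖_v = ∏_{w ∣ v} ‖a‖_w` -/

section Global

variable {F : Type} (E : Type) [Field F] [NumberField F] [Field E] [NumberField E] [Algebra F E]
  (v : HeightOneSpectrum (𝓞 F))

open scoped Classical in
/-- the datum concentrated at `v`: `𝔮 ↦ ofAdd [𝔮 = v]` in `Multiplicative ℤ`. [folklore] -/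
private theorem artinHom_ite_apply (I : (FractionalIdeal (𝓞 F)⁰ F)ˣ) :
    artinHom (fun 𝔮 : HeightOneSpectrum (𝓞 F) => if 𝔮 = v then Multiplicative.ofAdd (1 : ℤ) else 1) I =
      Multiplicative.ofAdd (FractionalIdeal.count F v (I : FractionalIdeal (𝓞 F)⁰ F)) := by
  rw [artinHom_apply, finprod_eq_single _ v fun 𝔮 h𝔮 => by rw [if_neg h𝔮, one_zpow], if_pos rfl,
    ← ofAdd_zsmul, zsmul_eq_mul, Int.cast_id, mul_one]

variable {ι : Type*} in
/-- `a ^ (∑ f) = ∏ a ^ f` for a nonzero real base and integer exponents. [folklore] -/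
private theorem zpow_finset_sum (s : Finset ι) {a : ℝ} (ha : a ≠ 0) (f : ι → ℤ) :
    a ^ (∑ i ∈ s, f i) = ∏ i ∈ s, a ^ f i := by
  classical
  induction s using Finset.induction_on with
  | empty => rw [Finset.sum_empty, Finset.prod_empty, zpow_zero]
  | insert i s hi ih => rw [Finset.sum_insert hi, Finset.prod_insert hi, zpow_add₀ ha, ih]

/-- **`ν_v(N_{E/F} 𝔄) = ∑_{w ∣ v} f(w|v) ν_w(𝔄)`** for an invertible fractional ideal `𝔄` of `E`
(`N_{E/F} 𝔔 = 𝔮^{f(𝔔|𝔮)}` extended multiplicatively). [cite: NeukirchANT1999, Ch. III (1.6)] -/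
theorem count_relIdealNorm (I : (FractionalIdeal (𝓞 E)⁰ E)ˣ) :
    FractionalIdeal.count F v ((relIdealNorm F E I : (FractionalIdeal (𝓞 F)⁰ F)ˣ) : FractionalIdeal (𝓞 F)⁰ F) =
      ∑ w : PlacesOver E v, (w.1.asIdeal.inertiaDeg (𝓞 F) : ℤ) *
        FractionalIdeal.count E w.1 (I : FractionalIdeal (𝓞 E)⁰ E) := by
  classical
  have h := artinHom_relIdealNorm
    (fun 𝔮 : HeightOneSpectrum (𝓞 F) => if 𝔮 = v then Multiplicative.ofAdd (1 : ℤ) else 1) I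
  rw [artinHom_ite_apply, artinHom_apply] at h
  rw [finprod_eq_prod_of_mulSupport_subset _
      (s := (Finset.univ : Finset (PlacesOver E v)).map (Function.Embedding.subtype _)) ?_,
    Finset.prod_map] at h
  · apply_fun Multiplicative.toAdd at h
    rw [toAdd_ofAdd, toAdd_prod] at h
    rw [h]
    refine Finset.sum_congr rfl fun w _ => ?_
    rw [Function.Embedding.coe_subtype, if_pos w.2, toAdd_zpow, toAdd_pow, toAdd_ofAdd, nsmul_eq_mul,
      zsmul_eq_mul, Int.cast_id, mul_one, mul_comm]
  · intro Q hQ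
    rw [Function.mem_mulSupport] at hQ
    have hQv : Q.under (𝓞 F) = v := by
      by_contra hne
      exact hQ (by rw [if_neg hne, one_pow, one_zpow])
    exact Finset.mem_coe.2 (Finset.mem_map.2 ⟨⟨Q, hQv⟩, Finset.mem_univ _, rfl⟩)

/-- **`‖x‖_𝔮 = N𝔮 ^ (-ν_𝔮((x)))`** for `x ∈ Kˣ`, `K` a number field, `𝔮` a finite place.
[cite: CasselsFrohlichANT1967, Ch. II §11] -/
theorem norm_coe_units_eq_absNorm_zpow {K : Type} [Field K] [NumberField K] (𝔮 : HeightOneSpectrum (𝓞 K))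
    (x : Kˣ) :
    ‖((x : K) : 𝔮.adicCompletion K)‖ =
      ((Ideal.absNorm 𝔮.asIdeal : ℕ) : ℝ) ^
        (-FractionalIdeal.count K 𝔮 (toPrincipalIdeal (𝓞 K) K x : FractionalIdeal (𝓞 K)⁰ K)) := by
  refine Ultrametric.AdicCompletion.norm_eq_absNorm_zpow K 𝔮 _ ?_
  rw [adicCompletion.valued_coe, count_toPrincipalIdeal, neg_neg]
  exact (WithZero.exp_log ((Valuation.ne_zero_iff _).2 x.ne_zero)).symm

/-- **`‖N_{E/F} a‖_v = ∏_{w ∣ v} ‖a‖_w`** for `a ∈ Eˣ` and a finite place `v` of `F`: from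
`N_{E/F}((a)) = (N_{E/F} a)`, `ν_v(N 𝔄) = ∑_{w ∣ v} f_w ν_w(𝔄)` and `N(w) = N(v)^{f_w}`.
[cite: CasselsFrohlichANT1967, Ch. II §11] -/
theorem norm_algebraNorm_coe_eq_prod (a : Eˣ) :
    ‖((Algebra.norm F (a : E) : F) : v.adicCompletion F)‖ =
      ∏ w : PlacesOver E v, ‖((a : E) : w.1.adicCompletion E)‖ := by
  have hN : (Algebra.norm F (a : E) : F) = ((Units.map (Algebra.norm F : E →* F) a : Fˣ) : F) := rfl
  have hb : ((Ideal.absNorm v.asIdeal : ℕ) : ℝ) ≠ 0 :=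
    Nat.cast_ne_zero.2 (by have := Ultrametric.AdicCompletion.two_le_absNorm F v; omega)
  rw [hN, norm_coe_units_eq_absNorm_zpow v, ← relIdealNorm_toPrincipalIdeal, count_relIdealNorm E v,
    ← Finset.sum_neg_distrib, zpow_finset_sum _ hb]
  refine Finset.prod_congr rfl fun w _ => ?_
  haveI := PlacesOver.liesOver w
  haveI := v.isMaximal
  haveI := w.1.isMaximal
  rw [norm_coe_units_eq_absNorm_zpow w.1 a,
    Ideal.absNorm_eq_pow_inertiaDeg'_of_liesOver w.1.asIdeal v.asIdeal v.isPrime v.ne_bot,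
    Ideal.inertiaDeg'_eq_inertiaDeg, Nat.cast_pow, ← zpow_natCast, ← zpow_mul, ← neg_mul_eq_mul_neg]

end Global

/-! ## 2. The quadratic case: `‖N_{E ⊗_F F_v / F_v} y‖_v = ∏_{w ∣ v} ‖y_w‖_w` -/

section Quadratic

variable {F : Type} (E : Type) [Field F] [NumberField F] [Field E] [NumberField E] [Algebra F E]
  [Algebra.IsQuadraticExtension F E] (v : HeightOneSpectrum (𝓞 F))

/-- **The norm form in the coordinates `(1, δ)`**: `N_{E⊗F_v/F_v}(ι_v a + ι_v b · δ) = a² - d b²`, `δ² = d`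
(determinant of the matrix `(a, d b; b, a)` of multiplication by `ι_v a + ι_v b δ` in the `F_v`-basis `(1, δ ⊗ 1)`).
[cite: CasselsFrohlichANT1967, Ch. II §11] -/
theorem algebraNorm_quadraticLocalEquiv (σ : E ≃ₐ[F] E) {δ : E} (hσδ : σ δ = -δ) (hδ : δ ≠ 0) {d : F}
    (hd : δ * δ = algebraMap F E d) (a b : v.adicCompletion F) :
    Algebra.norm (v.adicCompletion F) (quadraticLocalEquiv E v σ hσδ hδ (a, b)) =
      a * a - (d : v.adicCompletion F) * (b * b) := by
  classical
  set Ψ := quadraticLocalEquiv E v σ hσδ hδ with hΨ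
  let e : LocalRing E v ≃ₗ[v.adicCompletion F] (Fin 2 → v.adicCompletion F) :=
    Ψ.symm.toLinearEquiv ≪≫ₗ (LinearEquiv.finTwoArrow (v.adicCompletion F) (v.adicCompletion F)).symm
  let bs : Module.Basis (Fin 2) (v.adicCompletion F) (LocalRing E v) := Module.Basis.ofEquivFun e
  have he : ∀ p : v.adicCompletion F × v.adicCompletion F, e (Ψ p) = ![p.1, p.2] := fun p => by
    simp only [e, LinearEquiv.trans_apply, ContinuousLinearEquiv.coe_toLinearEquiv,
      ContinuousLinearEquiv.symm_apply_apply, LinearEquiv.finTwoArrow_symm_apply]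
  have hsymm : ∀ f : Fin 2 → v.adicCompletion F, e.symm f = Ψ (f 0, f 1) := fun f => by
    apply e.injective
    rw [LinearEquiv.apply_symm_apply, he]
    ext i
    fin_cases i <;> rfl
  have hb0 : bs 0 = 1 := by
    simp only [bs, Module.Basis.coe_ofEquivFun]
    rw [hsymm, Pi.single_eq_same, Pi.single_eq_of_ne (by decide : (1 : Fin 2) ≠ 0), hΨ,
      quadraticLocalEquiv_apply, map_one, map_zero, zero_mul, add_zero]
  have hb1 : bs 1 = algebraMap E (LocalRing E v) δ := by
    simp only [bs, Module.Basis.coe_ofEquivFun]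
    rw [hsymm, Pi.single_eq_same, Pi.single_eq_of_ne (by decide : (0 : Fin 2) ≠ 1), hΨ,
      quadraticLocalEquiv_apply, map_one, map_zero, one_mul, zero_add]
  rw [Algebra.norm_eq_matrix_det bs, Matrix.det_fin_two, Algebra.leftMulMatrix_eq_repr_mul,
    Algebra.leftMulMatrix_eq_repr_mul, Algebra.leftMulMatrix_eq_repr_mul, Algebra.leftMulMatrix_eq_repr_mul,
    hb0, hb1, mul_one, mul_comm (Ψ (a, b)) (algebraMap E (LocalRing E v) δ),
    algebraMap_mul_quadraticLocalEquiv E v σ hσδ hδ hd, ← hΨ]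
  simp only [bs, Module.Basis.ofEquivFun_repr_apply, he, Matrix.cons_val_zero, Matrix.cons_val_one]
  ring

omit [NumberField F] [Algebra.IsQuadraticExtension F E] in
/-- For `σ δ = -δ ≠ 0`: `σ ≠ 1` (characteristic `0`). [folklore] -/
private theorem algEquiv_ne_one (σ : E ≃ₐ[F] E) {δ : E} (hσδ : σ δ = -δ) (hδ : δ ≠ 0) : σ ≠ 1 := by
  rintro rfl
  rw [AlgEquiv.one_apply] at hσδ
  exact hδ ((mul_eq_zero.mp (by linear_combination hσδ : (2 : E) * δ = 0)).resolve_left two_ne_zero)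

open scoped Classical in
/-- For a quadratic extension, `Aut(E/F) = {1, σ}` whenever `σ δ = -δ ≠ 0`. [folklore] -/
private theorem univ_algEquiv_eq_pair (σ : E ≃ₐ[F] E) {δ : E} (hσδ : σ δ = -δ) (hδ : δ ≠ 0) :
    (Finset.univ : Finset (E ≃ₐ[F] E)) = {1, σ} := by
  symm
  apply Finset.eq_univ_of_card
  rw [Finset.card_pair (algEquiv_ne_one E σ hσδ hδ).symm, ← Nat.card_eq_fintype_card,
    IsGalois.card_aut_eq_finrank, Algebra.IsQuadraticExtension.finrank_eq_two F E]

/-- **`N_{E/F} x = x · σ x`** for a quadratic extension with non-trivial automorphism `σ` (the norm is the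
product of the conjugates, `Aut(E/F) = {1, σ}`). [cite: NeukirchANT1999, Ch. I §2 Prop. (2.6) (ii)] -/
theorem algebraMap_algebraNorm_eq_mul (σ : E ≃ₐ[F] E) {δ : E} (hσδ : σ δ = -δ) (hδ : δ ≠ 0) (x : E) :
    algebraMap F E (Algebra.norm F x) = x * σ x := by
  classical
  rw [Algebra.norm_eq_prod_automorphisms, univ_algEquiv_eq_pair E σ hσδ hδ,
    Finset.prod_pair (algEquiv_ne_one E σ hσδ hδ).symm, AlgEquiv.one_apply]

/-- **`ι_v(N_{E⊗F_v/F_v} y) = y · (σ ⊗ 1) y`**: the norm of the quadratic étale `F_v`-algebra `∏_{w ∣ v} E_w` is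
`y ȳ` (`(ι_v a + ι_v b δ)(ι_v a - ι_v b δ) = ι_v (a² - d b²)`). [cite: CasselsFrohlichANT1967, Ch. II §11] -/
theorem toLocalRing_algebraNorm (σ : E ≃ₐ[F] E) {δ : E} (hσδ : σ δ = -δ) (hδ : δ ≠ 0) (y : LocalRing E v) :
    toLocalRing E v (Algebra.norm (v.adicCompletion F) y) = y * conjLocal E σ v y := by
  obtain ⟨d, hd⟩ := exists_mul_self_eq_algebraMap E σ hσδ hδ
  obtain ⟨⟨a, b⟩, rfl⟩ := (quadraticLocalEquiv E v σ hσδ hδ).surjective y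
  rw [algebraNorm_quadraticLocalEquiv E v σ hσδ hδ hd, conjLocal_quadraticLocalEquiv,
    quadraticLocalEquiv_apply, quadraticLocalEquiv_apply]
  dsimp only
  have hdd : algebraMap E (LocalRing E v) δ * algebraMap E (LocalRing E v) δ =
      toLocalRing E v (d : v.adicCompletion F) := by
    rw [← map_mul, hd, toLocalRing_coe]
  simp only [map_sub, map_mul, map_neg]
  linear_combination (toLocalRing E v b * toLocalRing E v b) * hdd

/-- **Base change: `N_{E⊗F_v/F_v}(x ⊗ 1) = N_{E/F}(x)`** (read in `F_v`). [cite: CasselsFrohlichANT1967, Ch. II §11] -/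
theorem algebraNorm_localRing_algebraMap (x : E) :
    Algebra.norm (v.adicCompletion F) (algebraMap E (LocalRing E v) x) =
      ((Algebra.norm F x : F) : v.adicCompletion F) := by
  obtain ⟨σ, δ, hσδ, hδ⟩ := exists_algEquiv_apply_eq_neg (F := F) (E := E)
  apply toLocalRing_injective E v
  rw [toLocalRing_algebraNorm E v σ hσδ hδ, conjLocal_algebraMap, ← map_mul,
    ← algebraMap_algebraNorm_eq_mul E σ hσδ hδ, toLocalRing_coe]

/-- The norm `N_{E⊗F_v/F_v} : ∏_{w ∣ v} E_w → F_v` is continuous (a polynomial in the coordinates `(a, b)` of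
`quadraticLocalEquiv`). [folklore] -/
private theorem continuous_algebraNorm_localRing :
    Continuous fun y : LocalRing E v => Algebra.norm (v.adicCompletion F) y := by
  obtain ⟨σ, δ, hσδ, hδ⟩ := exists_algEquiv_apply_eq_neg (F := F) (E := E)
  obtain ⟨d, hd⟩ := exists_mul_self_eq_algebraMap E σ hσδ hδ
  set Ψ := quadraticLocalEquiv E v σ hσδ hδ with hΨ
  have heq : (fun y : LocalRing E v => Algebra.norm (v.adicCompletion F) y) =
      fun y => (Ψ.symm y).1 * (Ψ.symm y).1 - (d : v.adicCompletion F) * ((Ψ.symm y).2 * (Ψ.symm y).2) := by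
    funext y
    conv_lhs => rw [← Ψ.apply_symm_apply y]
    rw [← algebraNorm_quadraticLocalEquiv E v σ hσδ hδ hd (Ψ.symm y).1 (Ψ.symm y).2]
  rw [heq]
  have h1 : Continuous fun y : LocalRing E v => (Ψ.symm y).1 := continuous_fst.comp Ψ.symm.continuous
  have h2 : Continuous fun y : LocalRing E v => (Ψ.symm y).2 := continuous_snd.comp Ψ.symm.continuous
  exact (h1.mul h1).sub (continuous_const.mul (h2.mul h2))

/-- **`‖N_{E ⊗_F F_v / F_v} y‖_v = ∏_{w ∣ v} ‖y_w‖_w`** for every `y ∈ E ⊗_F F_v = ∏_{w ∣ v} E_w` (quadratic `E/F`,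
`v` a finite place of `F`, Mathlib's normalised absolute values): both sides are continuous in `y` and agree on the
dense image of `E` by `‖N_{E/F} x‖_v = ∏_{w ∣ v} ‖x‖_w`. [cite: CasselsFrohlichANT1967, Ch. II §11] -/
theorem norm_algebraNorm_localRing (y : LocalRing E v) :
    ‖Algebra.norm (v.adicCompletion F) y‖ = ∏ w : PlacesOver E v, ‖y w‖ := by
  refine (denseRange_algebraMap_localRing E v).induction_on
    (p := fun y : LocalRing E v => ‖Algebra.norm (v.adicCompletion F) y‖ = ∏ w : PlacesOver E v, ‖y w‖) y
    (isClosed_eq (continuous_norm.comp (continuous_algebraNorm_localRing E v))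
      (continuous_finsetProd _ fun w _ => continuous_norm.comp (continuous_apply w))) fun x => ?_
  by_cases hx : x = 0
  · subst hx
    obtain ⟨w₀⟩ := PlacesOver.nonempty E v
    rw [map_zero, Algebra.norm_zero, norm_zero, Finset.prod_eq_zero (Finset.mem_univ w₀)]
    rw [Pi.zero_apply, norm_zero]
  · have h := norm_algebraNorm_coe_eq_prod E v (Units.mk0 x hx)
    simp only [Units.val_mk0] at h
    rw [algebraNorm_localRing_algebraMap, h]
    rfl

end Quadratic

end Literature.NumberTheory.Automorphic.UnitaryGroup

end
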